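import Summits.Ventures.GridStability.Models.SMIBInstances
import Literature.MathematicalPhysics.PowerSystems.SMIBEnergyRegionOfAttraction
import Mathlib.Analysis.SpecialFunctions.Trigonometric.Bounds
import Mathlib.Analysis.Real.Pi.Bounds

/-!
# GridStability/Models/SMIBEnergyRoa — the ENERGY route (textbook energy well ⊆ ROA) on model-1's SMIB and on the instance of record «SMIB-K13post-D10»

Cell `gridfusion` (LADDER-GRIDFUSION rungs G3 → G1.SMIB), seat gridfusion-model-1, `plan/PARTITION.md`
§0 row `Models/` + A12 («nothing typed twice»). THREE COLUMNS: MODELLED column only (model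
`M_smib`, MODEL-VALIDITY MV-1); the theorems are a-priori statements about solutions of the typed
model, proved in the kernel from lit-6's Barbashin–Krasovskii–LaSalle assembly — NOT SOS certificates
and not statements about any machine or grid.

## Why this file

The cell holds TWO typings of the classical single-machine-infinite-bus model: lit-2's printed record
`Literature.MathematicalPhysics.PowerSystems.SMIB = ⟨M, D, P_m, P_e^max⟩` [cite: SauerPai1998, §9.6.2
(9.30)] — over which lit-6 PROVED the textbook energy-well region of attraction
(`SMIB.energyWell_subset_regionOfAttraction`, p465446) and lit-1 the equal-area criterion
(`SMIBEqualAreaCriterion`, p475941) — and model-1's `Models.SMIB = ⟨M, D, P_m, P_C, P_M, γ⟩`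
(Anderson–Fouad (2.41) with `P_C`, `γ`; p460909), over which the instance of record «SMIB-K13post-D10»
(`SMIB.K13postD10`, p463796) and the kernel SOS certificates / -roa sentences live (p462567, p463941,
…). model-3 bridged the two only THROUGH the droop-inverter parameters (`InverterBridgesSMIB`,
p462458). This file gives the direct dictionary and transports the energy route to model-1's record
and to the instance of record, so that the energy route and the SOS route are kernel statements about
THE SAME typed object:

* `SMIB.toLit p = ⟨M, D, P_m − P_C, P_M⟩` and, for `γ = 0`: same vector field (`toLit_vectorField`),
  same energy function (`toLit_energy`), same equilibria (`toLit_isEquilibriumAngle_iff`), same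
  solutions (`isSolutionOn_iff_toLit`);
* `SMIB.energyWell_roa` — lit-6's theorem read on model-1's record: for `γ = 0`, `M, D, P_M > 0`,
  an equilibrium angle `0 ≤ δˢ < π/2` and any level `c < V_cr(δˢ) = −(P_m − P_C)(π − 2δˢ) + 2P_M cos δˢ`,
  every state in the window `δ − δˢ… ∈ (−π − δˢ, π − δˢ)` with `V ≤ c` has a global solution and EVERY
  solution from it stays in the well and tends to `(δˢ, 0)`; `SMIB.energyWell_roa_Ici` — the same
  for solutions given on `[0, ∞)` (the convention of the SOS -roa files);
* instance facts for «SMIB-K13post-D10» (Kundur Ex. 13 post-fault, `K_D = 10`, A1″ `t = 1225/2367`):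
  `K13postD10_toLit` (lit-2 record `⟨7/377, 10/377, 79912287/88791425, 689/625⟩`), certified
  enclosure of the equilibrium angle `191/200 < δˢ < π/2` (`deltaK13_gt`, by `1 − x²/2 ≤ cos x` at
  `δ/16` and four exact angle doublings; `deltaK13_lt_pi_div_two`), the critical energy in closed
  form `V_cr = 2·(689/625)·c* − P_m′(π − 2δˢ)` (`K13postD10_criticalEnergy_eq`) with the certified
  rational under-approximation `0.1648 < V_cr` (`K13postD10_criticalEnergy_gt`; float value
  0.16508, lit-1 23:58:33Z), and the hypothesis-free corollary `K13postD10_energyWell_roa`: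
  every solution of the instance from the window with `V(δ₀, ω₀) ≤ 0.1648` resynchronises.

VALIDATED-column use (not a claim of this file): the energy route certifies the sublevel set
`{V ≤ 0.1648}` of the ENERGY function; the SOS route (p463941) certifies `{V_SOS ≤ γ}` of a different
quadratic/quartic `V_SOS` in the recast variables — two inner estimates of the same model's ROA.
MODELLED: MV-1 (classical SMIB; `P_m′` per A1″, MV-P).
-/

noncomputable section

open Real Set Filter Topology

namespace Summit.Ventures.GridStability.Models.SMIB

variable (p : SMIB)

/-! ## The dictionary model-1 `Models.SMIB` (γ = 0) ↔ lit-2 `PowerSystems.SMIB` -/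

/-- lit-2's printed SMIB record [cite: SauerPai1998, §9.6.2 (9.30)] of a model-1 SMIB: inertia and
damping coefficients unchanged, mechanical input net of the constant term `P_m − P_C`, amplitude
`P_e^max = P_M`. Faithful when `γ = 0` (the lossless reduced two-node network of (9.30)). -/
def toLit : Literature.MathematicalPhysics.PowerSystems.SMIB where
  M := p.M
  D := p.D
  Pm := p.Pm - p.PC
  Pmax := p.PM

/-- The dictionary keeps the inertia coefficient. -/
@[simp] theorem toLit_M : p.toLit.M = p.M := rfl
/-- The dictionary keeps the damping coefficient. -/
@[simp] theorem toLit_D : p.toLit.D = p.D := rfl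
/-- lit-2's mechanical input is model-1's `P_m − P_C`. -/
@[simp] theorem toLit_Pm : p.toLit.Pm = p.Pm - p.PC := rfl
/-- lit-2's `P_e^max` is model-1's `P_M`. -/
@[simp] theorem toLit_Pmax : p.toLit.Pmax = p.PM := rfl

variable {p}

/-- Same vector field: lit-2's `(ω, (P_m − P_e^max sin δ − Dω)/M)` of `toLit p` is model-1's
`SMIB.field` (Anderson–Fouad (2.42)) when `γ = 0`. -/
theorem toLit_vectorField (hγ : p.γ = 0) (x : ℝ × ℝ) : p.toLit.vectorField x = p.field x := by
  simp only [Literature.MathematicalPhysics.PowerSystems.SMIB.vectorField,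
    Literature.MathematicalPhysics.PowerSystems.SMIB.accel, field, Pe, toLit, hγ, sub_zero]
  ext <;> simp; ring

/-- Same energy function: Sauer–Pai (9.35) `½Mω² + V_PE(δ, δˢ)` of `toLit p` is model-1's
`SMIB.energy` (A–F §2.8 energy integral) when `γ = 0`. -/
theorem toLit_energy (hγ : p.γ = 0) (δs : ℝ) (x : ℝ × ℝ) :
    p.toLit.energy δs x = p.energy δs x := by
  simp only [Literature.MathematicalPhysics.PowerSystems.SMIB.energy,
    Literature.MathematicalPhysics.PowerSystems.SMIB.potentialEnergy, energy, toLit, hγ, sub_zero]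
  ring

/-- Same equilibria: `P_m − P_C = P_M sin δˢ` ⟺ `P_e(δˢ) = P_m` when `γ = 0`. -/
theorem toLit_isEquilibriumAngle_iff (hγ : p.γ = 0) (δs : ℝ) :
    p.toLit.IsEquilibriumAngle δs ↔ p.IsEquilibrium δs := by
  rw [isEquilibrium_iff, Literature.MathematicalPhysics.PowerSystems.SMIB.IsEquilibriumAngle, toLit,
    hγ, sub_zero]
  constructor <;> intro h <;> linarith

/-- Same solutions: model-1's `IsSolutionOn` is the within-derivative solution notion of lit-6 /
lit-1 for the vector field of `toLit p` (γ = 0). -/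
theorem isSolutionOn_iff_toLit (hγ : p.γ = 0) (c : ℝ → ℝ × ℝ) (s : Set ℝ) :
    p.IsSolutionOn c s ↔ ∀ t ∈ s, HasDerivWithinAt c (p.toLit.vectorField (c t)) s t := by
  simp only [IsSolutionOn, toLit_vectorField hγ]

/-! ## The energy route on model-1's record (transport of lit-6 p465446) -/

/-- **Energy well ⊆ region of attraction, on model-1's SMIB (γ = 0).** MODELLED: `M_smib`
(Anderson–Fouad (2.40)–(2.42) + damping (5.157)), MV-1. For `M, D, P_M > 0`, an equilibrium angle
`0 ≤ δˢ < π/2` and any level `c < V_cr(δˢ)` (`toLit.criticalEnergy`, Sauer–Pai (9.46)): from every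
state `y` with `y.1 ∈ (−π − δˢ, π − δˢ)` and `V(y) ≤ c` a solution on every `[0, T]` exists, and
EVERY such solution stays in the window with `V ≤ c` and tends to `(δˢ, 0)`. Transport of
`Literature…SMIB.energyWell_subset_regionOfAttraction` (lit-6) through the dictionary above; no
certificate involved. [cite: SauerPai1998, §9.6.2–§9.6.3] -/
theorem energyWell_roa (hγ : p.γ = 0) (hM : 0 < p.M) (hD : 0 < p.D) (hPM : 0 < p.PM)
    {δs : ℝ} (heq : p.IsEquilibrium δs) (h0 : 0 ≤ δs) (h1 : δs < π / 2) {c : ℝ}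
    (hc : c < p.toLit.criticalEnergy δs) {y : ℝ × ℝ} (hy₁ : y.1 ∈ Ioo (-π - δs) (π - δs))
    (hy₂ : p.energy δs y ≤ c) :
    (∃ X : ℝ → ℝ × ℝ, X 0 = y ∧ ∀ T : ℝ, p.IsSolutionOn X (Icc 0 T)) ∧
    ∀ X : ℝ → ℝ × ℝ, X 0 = y → (∀ T : ℝ, p.IsSolutionOn X (Icc 0 T)) →
      (∀ t, 0 ≤ t → (X t).1 ∈ Ioo (-π - δs) (π - δs) ∧ p.energy δs (X t) ≤ c) ∧
        Tendsto X atTop (𝓝 (δs, 0)) := by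
  have heq' : p.toLit.IsEquilibriumAngle δs := (toLit_isEquilibriumAngle_iff hγ δs).2 heq
  have hy₂' : p.toLit.energy δs y ≤ c := by rwa [toLit_energy hγ]
  obtain ⟨⟨X, hX0, hX⟩, hall⟩ :=
    p.toLit.energyWell_subset_regionOfAttraction hM hD hPM heq' h0 h1 hc hy₁ hy₂'
  refine ⟨⟨X, hX0, fun T => (isSolutionOn_iff_toLit hγ X _).2 (hX T)⟩, fun X hX0 hX => ?_⟩
  obtain ⟨hstay, hlim⟩ := hall X hX0 fun T => (isSolutionOn_iff_toLit hγ X _).1 (hX T)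
  exact ⟨fun t ht => by simpa [toLit_energy hγ] using hstay t ht, hlim⟩

/-- A solution on `[0, ∞)` (the convention of the cell's SOS -roa files, e.g. p463941) is a
solution on every `[0, T]`. -/
theorem IsSolutionOn.restrict_Icc {c : ℝ → ℝ × ℝ} (h : p.IsSolutionOn c (Ici 0)) (T : ℝ) :
    p.IsSolutionOn c (Icc 0 T) :=
  fun t ht => (h t ht.1).mono Icc_subset_Ici_self

/-- **Energy route, «every solution» half, for solutions given on `[0, ∞)`.** Same hypotheses as
`energyWell_roa`; conclusion for every `p.IsSolutionOn X (Ici 0)` from the well: the window and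
`V ≤ c` are kept for all `t ≥ 0` (no pole slip) and `X → (δˢ, 0)`. MODELLED: MV-1. -/
theorem energyWell_roa_Ici (hγ : p.γ = 0) (hM : 0 < p.M) (hD : 0 < p.D) (hPM : 0 < p.PM)
    {δs : ℝ} (heq : p.IsEquilibrium δs) (h0 : 0 ≤ δs) (h1 : δs < π / 2) {c : ℝ}
    (hc : c < p.toLit.criticalEnergy δs) {X : ℝ → ℝ × ℝ} (hX : p.IsSolutionOn X (Ici 0))
    (h₁ : (X 0).1 ∈ Ioo (-π - δs) (π - δs)) (h₂ : p.energy δs (X 0) ≤ c) :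
    (∀ t, 0 ≤ t → (X t).1 ∈ Ioo (-π - δs) (π - δs) ∧ p.energy δs (X t) ≤ c) ∧
      Tendsto X atTop (𝓝 (δs, 0)) :=
  (energyWell_roa hγ hM hD hPM heq h0 h1 hc h₁ h₂).2 X rfl hX.restrict_Icc

/-! ## Instance of record «SMIB-K13post-D10»: dictionary, angle enclosure, critical energy -/

/-- The lit-2 record of the instance of record: `⟨M, D, P_m, P_e^max⟩ = ⟨7/377, 10/377,
79912287/88791425, 689/625⟩` (Kundur Ex. 13 post-fault plant, `K_D = 10`, `P_m′` per A1″; the record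
lit-1 23:58:33Z asks for). -/
theorem K13postD10_toLit :
    K13postD10.toLit = ⟨7 / 377, 10 / 377, 79912287 / 88791425, 689 / 625⟩ := by
  simp only [toLit, K13postD10, sub_zero]

/-- `γ = 0` for the instance of record. -/
theorem K13postD10_γ : K13postD10.γ = 0 := rfl

/-- `0 < δˢ`: the equilibrium angle of record is positive (`s* > 0`). -/
theorem deltaK13_pos : 0 < deltaK13 := by
  rw [deltaK13]
  exact Real.arcsin_pos.2 (by norm_num [sStar])

/-- `δˢ < π/2` (`s* < 1`). -/
theorem deltaK13_lt_pi_div_two : deltaK13 < π / 2 := by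
  rw [deltaK13]
  exact Real.arcsin_lt_pi_div_two.2 (by norm_num [sStar])

/-- Angle doubling for a cosine LOWER bound: `0 ≤ l ≤ cos x` ⇒ `2l² − 1 ≤ cos (2x)`. -/
theorem cos_two_mul_ge {x l : ℝ} (hl : 0 ≤ l) (h : l ≤ cos x) : 2 * l ^ 2 - 1 ≤ cos (2 * x) := by
  rw [cos_two_mul]
  nlinarith [pow_le_pow_left₀ hl h 2]

/-- **Certified lower bound of the equilibrium angle of record: `191/200 < δˢ`**
(`δˢ = arcsin s* = 0.955150…`). Proof: `1 − x²/2 ≤ cos x` at `x = q/16`, four exact doublings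
(`cos_two_mul_ge`) give a rational `L ≤ cos q` with `c* < L`; since `cos δˢ = c*` and `cos` is
strictly decreasing on `[0, π]`, `q < δˢ`. -/
theorem deltaK13_gt : (191 / 200 : ℝ) < deltaK13 := by
  have hq : (191 / 200 : ℝ) = 2 * (2 * (2 * (2 * (191 / 3200 : ℝ)))) := by norm_num
  have h0 : (1 : ℝ) - (191 / 3200 : ℝ) ^ 2 / 2 ≤ cos (191 / 3200 : ℝ) := one_sub_sq_div_two_le_cos
  have h1 := cos_two_mul_ge (by norm_num) h0
  have h2 := cos_two_mul_ge (by norm_num) h1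
  have h3 := cos_two_mul_ge (by norm_num) h2
  have h4 := cos_two_mul_ge (by norm_num) h3
  rw [← hq] at h4
  have hc : (cStar : ℝ) < cos (191 / 200 : ℝ) := lt_of_lt_of_le (by norm_num [cStar]) h4
  by_contra hlt
  have hlt := not_lt.1 hlt
  have hπ : (191 / 200 : ℝ) ≤ π := by linarith [Real.pi_gt_three]
  rcases hlt.lt_or_eq with hlt' | heq
  · have := Real.cos_lt_cos_of_nonneg_of_le_pi deltaK13_pos.le hπ hlt'
    rw [cos_deltaK13] at this
    linarith
  · rw [← heq, cos_deltaK13] at hc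
    exact lt_irrefl _ hc

/-- Critical energy of the instance of record in closed form:
`V_cr(δˢ) = −P_m′(π − 2δˢ) + 2P_M cos δˢ = 2·(689/625)·c* − (79912287/88791425)(π − 2δˢ)`
(Sauer–Pai (9.46); `cos δˢ = c*` exact). -/
theorem K13postD10_criticalEnergy_eq :
    K13postD10.toLit.criticalEnergy deltaK13 =
      2 * (689 / 625 : ℝ) * (cStar : ℝ) - (79912287 / 88791425 : ℝ) * (π - 2 * deltaK13) := by
  rw [Literature.MathematicalPhysics.PowerSystems.SMIB.criticalEnergy, K13postD10_toLit, cos_deltaK13]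
  ring

/-- **Certified rational under-approximation of the critical energy: `0.1648 < V_cr`** (float
`V_cr = 0.165078`; from `deltaK13_gt` and `π < 3.141593`). -/
theorem K13postD10_criticalEnergy_gt :
    (1648 / 10000 : ℝ) < K13postD10.toLit.criticalEnergy deltaK13 := by
  rw [K13postD10_criticalEnergy_eq]
  have hπ := Real.pi_lt_d6
  have hδ := deltaK13_gt
  norm_num [cStar] at hπ hδ ⊢
  nlinarith

/-- **Energy route on the instance of record (hypothesis-free except the data of the state).**
MODELLED: `M_smib` = «SMIB-K13post-D10» (Kundur Ex. 13 post-fault + `K_D = 10`, `P_m′` per A1″;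
MODEL-VALIDITY MV-1 + MV-P). STATEMENT: every solution `X = (δ, ω)` on `[0, ∞)` with
`δ(0) ∈ (−π − δˢ, π − δˢ)` and ENERGY `V(δ(0), ω(0)) ≤ 0.1648` keeps `δ(t)` in that window with
`V ≤ 0.1648` for all `t ≥ 0` and converges to `(δˢ, 0)`. Energy-function twin of the SOS -roa
sentence p463941 (different Lyapunov function, different certified set; both inner estimates).
No sentence here says a machine or a grid is stable. -/
theorem K13postD10_energyWell_roa {X : ℝ → ℝ × ℝ} (hX : K13postD10.IsSolutionOn X (Ici 0))
    (h₁ : (X 0).1 ∈ Ioo (-π - deltaK13) (π - deltaK13))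
    (h₂ : K13postD10.energy deltaK13 (X 0) ≤ 1648 / 10000) :
    (∀ t, 0 ≤ t → (X t).1 ∈ Ioo (-π - deltaK13) (π - deltaK13) ∧
        K13postD10.energy deltaK13 (X t) ≤ 1648 / 10000) ∧
      Tendsto X atTop (𝓝 (deltaK13, 0)) := by
  refine energyWell_roa_Ici K13postD10_γ (by norm_num [K13postD10]) (by norm_num [K13postD10])
    (by norm_num [K13postD10]) K13postD10_isEquilibrium deltaK13_pos.le deltaK13_lt_pi_div_two
    K13postD10_criticalEnergy_gt hX h₁ h₂

end Summit.Ventures.GridStability.Models.SMIB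

end
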